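import Summits.RiemannHypothesis.RiemannHypothesis.Theorems.PfPersistenceIntruderCapacitanceMonoMatrix

/-!
# THEORY 3 (gen 9) — the PIVOT LAW of the N-ladder: each rung adds a square over a Schur pivot
mechanism/rigidity campaign; no RH claims.

One-rung companion of `PfPersistenceIntruderCapacitanceMonoMatrix` (b6d59b293336). Border a real symmetric matrix
`B = B'.submatrix Fin.castSucc Fin.castSucc` by one row/column — new column `b i = B' iᶜ last`, new corner `β = B' last last` —
and a driver `d = d' ∘ Fin.castSucc` by one entry `ν = d' last`. With the OLD witness `B z = d` and the PIVOT witness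
`B y = b` (both solvable under coercivity, cf. `PfPersistenceIntruderWitness`), block elimination gives, PROVED and sorry-free:

* `mulVec_pivotVector`   — `B' (−y, 1) = (0, σ)` with the SCHUR PIVOT `σ = β − bᵀy`; hence `σ = (−y,1)ᵀ B' (−y,1)` (`schur_eq_form`),
                           `0 < σ` for positive-definite `B'` (`schur_pos`) and `σ ≤ β` when `B ≥ 0` (`schur_le_corner`).
* `pivot_witness`        — the bordered witness: `B' (z − t•y, t) = d'` with `t = (ν − bᵀz)/σ` (needs only `σ ≠ 0`).
* `dotProduct_witness_eq` — the capacitance `d'ᵀz'` does not depend on the witness (`B'` symmetric).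
* `pivot_law`            — THE LAW: for ANY witness `B' z'' = d'`,
                               `d'ᵀz'' − dᵀz = (ν − bᵀz)² / σ`,
                           i.e. the capacitance climbs the ladder by the SQUARE of the prediction error of the new driver entry
                           (`ν` versus the old window's prediction `bᵀz = bᵀB⁻¹d`) over the pivot; `pivot_law_nonneg`,
                           `pivot_law_pos_iff` (strict iff `ν ≠ bᵀz`), and the entry-computable floor
                           `(ν − bᵀz)²/β ≤ d'ᵀz'' − dᵀz` (`pivot_law_ge`).

All statements are over `Matrix (Fin (n+1)) (Fin (n+1)) ℝ`; nothing is ζ-specific and nothing here bears on RH in either direction.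
-/

set_option linter.dupNamespace false  -- the mandated namespace repeats `RiemannHypothesis`

noncomputable section

open Matrix Finset

namespace Summit.RiemannHypothesis.RiemannHypothesis.Theorems.PfPersistenceIntruderCapacitancePivot

open Summit.RiemannHypothesis.RiemannHypothesis.Theorems.PfPersistenceIntruderCapacitanceMonoMatrix
open Summit.RiemannHypothesis.RiemannHypothesis.Theorems.PfPersistence
open Summit.RiemannHypothesis.RiemannHypothesis.Theorems.PfPersistenceIntruderIndexMono

variable {n : ℕ}

/-- PROVED (bookkeeping): pairing against a bordered vector splits into the old block and the new entry. -/
theorem dotProduct_snoc (d' : Fin (n + 1) → ℝ) (x : Fin n → ℝ) (t : ℝ) :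
    d' ⬝ᵥ (Fin.snoc x t : Fin (n + 1) → ℝ) = (d' ∘ Fin.castSucc) ⬝ᵥ x + d' (Fin.last n) * t := by
  simp [dotProduct, Fin.sum_univ_castSucc]

/-- PROVED (bookkeeping): the old-block rows of `B'` applied to a bordered vector. -/
theorem mulVec_snoc_castSucc (B' : Matrix (Fin (n + 1)) (Fin (n + 1)) ℝ) (x : Fin n → ℝ) (t : ℝ)
    (k : Fin n) :
    (B' *ᵥ (Fin.snoc x t : Fin (n + 1) → ℝ)) (Fin.castSucc k) =
      (B'.submatrix Fin.castSucc Fin.castSucc *ᵥ x) k + B' (Fin.castSucc k) (Fin.last n) * t := by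
  simp [mulVec, dotProduct, Fin.sum_univ_castSucc, Matrix.submatrix_apply]

/-- PROVED (bookkeeping): the new row of `B'` applied to a bordered vector. -/
theorem mulVec_snoc_last (B' : Matrix (Fin (n + 1)) (Fin (n + 1)) ℝ) (x : Fin n → ℝ) (t : ℝ) :
    (B' *ᵥ (Fin.snoc x t : Fin (n + 1) → ℝ)) (Fin.last n) =
      (fun i => B' (Fin.last n) (Fin.castSucc i)) ⬝ᵥ x + B' (Fin.last n) (Fin.last n) * t := by
  simp [mulVec, dotProduct, Fin.sum_univ_castSucc]

/-- PROVED: for symmetric `B'` the new ROW equals the new COLUMN `b`. -/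
theorem lastRow_eq_of_isSymm {B' : Matrix (Fin (n + 1)) (Fin (n + 1)) ℝ} (hB' : B'.IsSymm) :
    (fun i => B' (Fin.last n) (Fin.castSucc i)) = fun i => B' (Fin.castSucc i) (Fin.last n) := by
  funext i
  exact hB'.apply (Fin.castSucc i) (Fin.last n)

/-- PROVED (the pivot vector): with the pivot witness `B y = b`, `B' (−y, 1) = (0, σ)`, `σ = β − bᵀy` the SCHUR PIVOT. -/
theorem mulVec_pivotVector {B' : Matrix (Fin (n + 1)) (Fin (n + 1)) ℝ} (hB' : B'.IsSymm) {y : Fin n → ℝ}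
    (hy : B'.submatrix Fin.castSucc Fin.castSucc *ᵥ y = fun i => B' (Fin.castSucc i) (Fin.last n)) :
    B' *ᵥ (Fin.snoc (-y) 1 : Fin (n + 1) → ℝ) =
      Fin.snoc (0 : Fin n → ℝ)
        (B' (Fin.last n) (Fin.last n) - (fun i => B' (Fin.castSucc i) (Fin.last n)) ⬝ᵥ y) := by
  ext j
  refine Fin.lastCases ?_ (fun k => ?_) j
  · rw [mulVec_snoc_last, lastRow_eq_of_isSymm hB', Fin.snoc_last]
    simp [dotProduct_neg]
    ring
  · rw [mulVec_snoc_castSucc, Fin.snoc_castSucc, mulVec_neg, hy]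
    simp

/-- PROVED: the Schur pivot IS a value of the quadratic form of `B'`: `σ = (−y,1)ᵀ B' (−y,1)`. -/
theorem schur_eq_form {B' : Matrix (Fin (n + 1)) (Fin (n + 1)) ℝ} (hB' : B'.IsSymm) {y : Fin n → ℝ}
    (hy : B'.submatrix Fin.castSucc Fin.castSucc *ᵥ y = fun i => B' (Fin.castSucc i) (Fin.last n)) :
    B' (Fin.last n) (Fin.last n) - (fun i => B' (Fin.castSucc i) (Fin.last n)) ⬝ᵥ y =
      (Fin.snoc (-y) 1 : Fin (n + 1) → ℝ) ⬝ᵥ (B' *ᵥ (Fin.snoc (-y) 1 : Fin (n + 1) → ℝ)) := by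
  rw [mulVec_pivotVector hB' hy, dotProduct_comm, dotProduct_snoc]
  simp

/-- PROVED: for positive-definite `B'` the pivot is POSITIVE (the pivot vector has last entry `1 ≠ 0`). -/
theorem schur_pos {B' : Matrix (Fin (n + 1)) (Fin (n + 1)) ℝ} (hB' : B'.IsSymm)
    (hpos : ∀ x : Fin (n + 1) → ℝ, x ≠ 0 → 0 < x ⬝ᵥ (B' *ᵥ x)) {y : Fin n → ℝ}
    (hy : B'.submatrix Fin.castSucc Fin.castSucc *ᵥ y = fun i => B' (Fin.castSucc i) (Fin.last n)) :
    0 < B' (Fin.last n) (Fin.last n) - (fun i => B' (Fin.castSucc i) (Fin.last n)) ⬝ᵥ y := by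
  rw [schur_eq_form hB' hy]
  refine hpos _ fun h => ?_
  have h1 := congrFun h (Fin.last n)
  simp at h1

/-- PROVED: the pivot never exceeds the new corner entry when the old block is nonnegative:
`σ = β − yᵀBy ≤ β`. -/
theorem schur_le_corner {B' : Matrix (Fin (n + 1)) (Fin (n + 1)) ℝ}
    (hnonneg : ∀ u : Fin n → ℝ, 0 ≤ u ⬝ᵥ (B'.submatrix Fin.castSucc Fin.castSucc *ᵥ u)) {y : Fin n → ℝ}
    (hy : B'.submatrix Fin.castSucc Fin.castSucc *ᵥ y = fun i => B' (Fin.castSucc i) (Fin.last n)) :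
    B' (Fin.last n) (Fin.last n) - (fun i => B' (Fin.castSucc i) (Fin.last n)) ⬝ᵥ y ≤
      B' (Fin.last n) (Fin.last n) := by
  have h : (fun i => B' (Fin.castSucc i) (Fin.last n)) ⬝ᵥ y = y ⬝ᵥ (B'.submatrix Fin.castSucc Fin.castSucc *ᵥ y) := by
    rw [hy, dotProduct_comm]
  linarith [hnonneg y]

/-- PROVED (the bordered witness by block elimination): with `σ ≠ 0` and `t = (ν − bᵀz)/σ`,
`B' (z − t•y, t) = d'`. -/
theorem pivot_witness {B' : Matrix (Fin (n + 1)) (Fin (n + 1)) ℝ} (hB' : B'.IsSymm) {d' : Fin (n + 1) → ℝ}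
    {z y : Fin n → ℝ} (hz : B'.submatrix Fin.castSucc Fin.castSucc *ᵥ z = d' ∘ Fin.castSucc)
    (hy : B'.submatrix Fin.castSucc Fin.castSucc *ᵥ y = fun i => B' (Fin.castSucc i) (Fin.last n))
    (hσ : B' (Fin.last n) (Fin.last n) - (fun i => B' (Fin.castSucc i) (Fin.last n)) ⬝ᵥ y ≠ 0) :
    B' *ᵥ (Fin.snoc
        (z - ((d' (Fin.last n) - (fun i => B' (Fin.castSucc i) (Fin.last n)) ⬝ᵥ z) /
              (B' (Fin.last n) (Fin.last n) - (fun i => B' (Fin.castSucc i) (Fin.last n)) ⬝ᵥ y)) • y)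
        ((d' (Fin.last n) - (fun i => B' (Fin.castSucc i) (Fin.last n)) ⬝ᵥ z) /
          (B' (Fin.last n) (Fin.last n) - (fun i => B' (Fin.castSucc i) (Fin.last n)) ⬝ᵥ y))
        : Fin (n + 1) → ℝ) = d' := by
  set b : Fin n → ℝ := fun i => B' (Fin.castSucc i) (Fin.last n) with hb
  set β : ℝ := B' (Fin.last n) (Fin.last n) with hβ
  set ν : ℝ := d' (Fin.last n) with hν
  set t : ℝ := (ν - b ⬝ᵥ z) / (β - b ⬝ᵥ y) with ht
  have htσ : t * (β - b ⬝ᵥ y) = ν - b ⬝ᵥ z := by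
    rw [ht]; exact div_mul_cancel₀ _ hσ
  ext j
  refine Fin.lastCases ?_ (fun k => ?_) j
  · rw [mulVec_snoc_last, lastRow_eq_of_isSymm hB']
    change b ⬝ᵥ (z - t • y) + β * t = d' (Fin.last n)
    rw [dotProduct_sub, dotProduct_smul, smul_eq_mul, ← hν]
    linear_combination htσ
  · rw [mulVec_snoc_castSucc, mulVec_sub, mulVec_smul, hz, hy]
    simp only [hb, Pi.sub_apply, Pi.smul_apply, smul_eq_mul, Function.comp_apply]
    ring

/-- PROVED: the capacitance `d'ᵀz'` is WITNESS-INDEPENDENT for symmetric `B'`. -/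
theorem dotProduct_witness_eq {m : ℕ} {M : Matrix (Fin m) (Fin m) ℝ} (hM : M.IsSymm) {v z z' : Fin m → ℝ}
    (hz : M *ᵥ z = v) (hz' : M *ᵥ z' = v) : v ⬝ᵥ z = v ⬝ᵥ z' := by
  calc v ⬝ᵥ z = (M *ᵥ z') ⬝ᵥ z := by rw [hz']
    _ = z ⬝ᵥ (M *ᵥ z') := dotProduct_comm _ _
    _ = z' ⬝ᵥ (M *ᵥ z) := dotProduct_mulVec_comm_of_isSymm hM z z'
    _ = z' ⬝ᵥ v := by rw [hz]
    _ = v ⬝ᵥ z' := dotProduct_comm _ _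

/-- PROVED — THE PIVOT LAW. Border `B = B'.submatrix castSucc castSucc` (symmetric `B'`) by the column `b`, corner `β`,
and the driver `d = d' ∘ castSucc` by `ν = d' last`; let `B z = d` (old witness), `B y = b` (pivot witness), `σ = β − bᵀy ≠ 0`.
Then for ANY new witness `B' z'' = d'`:  `d'ᵀz'' − dᵀz = (ν − bᵀz)² / σ`. -/
theorem pivot_law {B' : Matrix (Fin (n + 1)) (Fin (n + 1)) ℝ} (hB' : B'.IsSymm) {d' z'' : Fin (n + 1) → ℝ}
    {z y : Fin n → ℝ} (hz : B'.submatrix Fin.castSucc Fin.castSucc *ᵥ z = d' ∘ Fin.castSucc)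
    (hy : B'.submatrix Fin.castSucc Fin.castSucc *ᵥ y = fun i => B' (Fin.castSucc i) (Fin.last n))
    (hσ : B' (Fin.last n) (Fin.last n) - (fun i => B' (Fin.castSucc i) (Fin.last n)) ⬝ᵥ y ≠ 0)
    (hz'' : B' *ᵥ z'' = d') :
    d' ⬝ᵥ z'' - (d' ∘ Fin.castSucc) ⬝ᵥ z =
      (d' (Fin.last n) - (fun i => B' (Fin.castSucc i) (Fin.last n)) ⬝ᵥ z) ^ 2 /
        (B' (Fin.last n) (Fin.last n) - (fun i => B' (Fin.castSucc i) (Fin.last n)) ⬝ᵥ y) := by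
  rw [← dotProduct_witness_eq hB' (pivot_witness hB' hz hy hσ) hz'', dotProduct_snoc, dotProduct_sub,
    dotProduct_smul, smul_eq_mul]
  set b : Fin n → ℝ := fun i => B' (Fin.castSucc i) (Fin.last n) with hb
  set β : ℝ := B' (Fin.last n) (Fin.last n) with hβ
  set ν : ℝ := d' (Fin.last n) with hν
  have hBs : (B'.submatrix Fin.castSucc Fin.castSucc).IsSymm := hB'.submatrix _
  have hdy : (d' ∘ Fin.castSucc) ⬝ᵥ y = b ⬝ᵥ z := by
    calc (d' ∘ Fin.castSucc) ⬝ᵥ y = (B'.submatrix Fin.castSucc Fin.castSucc *ᵥ z) ⬝ᵥ y := by rw [hz]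
      _ = y ⬝ᵥ (B'.submatrix Fin.castSucc Fin.castSucc *ᵥ z) := dotProduct_comm _ _
      _ = z ⬝ᵥ (B'.submatrix Fin.castSucc Fin.castSucc *ᵥ y) := dotProduct_mulVec_comm_of_isSymm hBs y z
      _ = z ⬝ᵥ b := by rw [hy]
      _ = b ⬝ᵥ z := dotProduct_comm _ _
  rw [hdy]
  field_simp
  ring

/-- PROVED: for positive-definite `B'` the rung increment is NONNEGATIVE (a square over a positive pivot). -/
theorem pivot_law_nonneg {B' : Matrix (Fin (n + 1)) (Fin (n + 1)) ℝ} (hB' : B'.IsSymm)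
    (hpos : ∀ x : Fin (n + 1) → ℝ, x ≠ 0 → 0 < x ⬝ᵥ (B' *ᵥ x)) {d' z'' : Fin (n + 1) → ℝ}
    {z y : Fin n → ℝ} (hz : B'.submatrix Fin.castSucc Fin.castSucc *ᵥ z = d' ∘ Fin.castSucc)
    (hy : B'.submatrix Fin.castSucc Fin.castSucc *ᵥ y = fun i => B' (Fin.castSucc i) (Fin.last n))
    (hz'' : B' *ᵥ z'' = d') : 0 ≤ d' ⬝ᵥ z'' - (d' ∘ Fin.castSucc) ⬝ᵥ z := by
  have hσ := schur_pos hB' hpos hy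
  rw [pivot_law hB' hz hy hσ.ne' hz'']
  positivity

/-- PROVED: the increment is STRICT iff the new driver entry differs from the old window's prediction, `ν ≠ bᵀz`. -/
theorem pivot_law_pos_iff {B' : Matrix (Fin (n + 1)) (Fin (n + 1)) ℝ} (hB' : B'.IsSymm)
    (hpos : ∀ x : Fin (n + 1) → ℝ, x ≠ 0 → 0 < x ⬝ᵥ (B' *ᵥ x)) {d' z'' : Fin (n + 1) → ℝ}
    {z y : Fin n → ℝ} (hz : B'.submatrix Fin.castSucc Fin.castSucc *ᵥ z = d' ∘ Fin.castSucc)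
    (hy : B'.submatrix Fin.castSucc Fin.castSucc *ᵥ y = fun i => B' (Fin.castSucc i) (Fin.last n))
    (hz'' : B' *ᵥ z'' = d') :
    0 < d' ⬝ᵥ z'' - (d' ∘ Fin.castSucc) ⬝ᵥ z ↔
      d' (Fin.last n) ≠ (fun i => B' (Fin.castSucc i) (Fin.last n)) ⬝ᵥ z := by
  have hσ := schur_pos hB' hpos hy
  rw [pivot_law hB' hz hy hσ.ne' hz'']
  constructor
  · intro h heq
    rw [heq, sub_self] at h
    simp at h
  · intro hne
    exact div_pos (by positivity) hσ

/-- PROVED (entry-computable floor): with the old block nonnegative and the corner `β > 0`,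
`(ν − bᵀz)² / β ≤ d'ᵀz'' − dᵀz` — each rung adds AT LEAST the squared prediction error over the new diagonal entry. -/
theorem pivot_law_ge {B' : Matrix (Fin (n + 1)) (Fin (n + 1)) ℝ} (hB' : B'.IsSymm)
    (hpos : ∀ x : Fin (n + 1) → ℝ, x ≠ 0 → 0 < x ⬝ᵥ (B' *ᵥ x)) {d' z'' : Fin (n + 1) → ℝ}
    {z y : Fin n → ℝ} (hz : B'.submatrix Fin.castSucc Fin.castSucc *ᵥ z = d' ∘ Fin.castSucc)
    (hy : B'.submatrix Fin.castSucc Fin.castSucc *ᵥ y = fun i => B' (Fin.castSucc i) (Fin.last n))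
    (hz'' : B' *ᵥ z'' = d') :
    (d' (Fin.last n) - (fun i => B' (Fin.castSucc i) (Fin.last n)) ⬝ᵥ z) ^ 2 /
        B' (Fin.last n) (Fin.last n) ≤ d' ⬝ᵥ z'' - (d' ∘ Fin.castSucc) ⬝ᵥ z := by
  have hσ := schur_pos hB' hpos hy
  have hnonneg : ∀ u : Fin n → ℝ, 0 ≤ u ⬝ᵥ (B'.submatrix Fin.castSucc Fin.castSucc *ᵥ u) := by
    intro u
    by_cases hu : u = 0
    · simp [hu]
    · have hext : (Fin.snoc u 0 : Fin (n + 1) → ℝ) ≠ 0 := by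
        intro h
        apply hu
        funext i
        have := congrFun h (Fin.castSucc i)
        simpa using this
      have h1 := hpos _ hext
      have h2 : (Fin.snoc u 0 : Fin (n + 1) → ℝ) ⬝ᵥ (B' *ᵥ (Fin.snoc u 0 : Fin (n + 1) → ℝ)) =
          u ⬝ᵥ (B'.submatrix Fin.castSucc Fin.castSucc *ᵥ u) := by
        rw [dotProduct_comm, dotProduct_snoc]
        simp only [mul_zero, add_zero]
        rw [dotProduct_comm]
        refine Finset.sum_congr rfl fun k _ => ?_
        simp only [Function.comp_apply, mulVec_snoc_castSucc, mul_zero, add_zero]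
      linarith [h2 ▸ h1]
  have hle := schur_le_corner hnonneg hy
  rw [pivot_law hB' hz hy hσ.ne' hz'']
  exact div_le_div_of_nonneg_left (by positivity) hσ hle

/-- PROVED (bookkeeping): `Fin.castSucc` is the `castLE` embedding of the one-rung extension `N ≤ N + 1`. -/
theorem castLE_eq_castSucc (N : ℕ) :
    (Fin.castLE (Nat.succ_le_succ (Nat.le_succ N)) : Fin (N + 1) → Fin (N + 1 + 1)) = Fin.castSucc := by
  funext i
  ext
  simp

/-- **Weight-table instance — one rung of the N-ladder** (every weight table `w`, every `a > 0`, every `N`, any on-line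
profiles `pⱼ` with couplings `κⱼ` on the rung `N + 1`, truncated to the rung `N`; any off-line driver `d'`): if the big remainder
`B' = evenBlock w (a, N+1) + ∑ⱼ κⱼ pⱼpⱼᵀ` is positive-definite, the old rung has a witness `B z = d' ∘ castSucc` and a pivot
witness `B y = b` (`b` = the new column of `B'`), then for ANY witness `B' z'' = d'` on the new rung
`d'ᵀz'' − (d'∘castSucc)ᵀz = (ν − bᵀz)²/σ` with `0 < σ = β − bᵀy`: the single-driver capacitance climbs by a square over the pivot.
[cite: HornJohnson2013, §0.8.5 (Schur complement) and Cor. 7.7.4] -/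
theorem evenBlock_pivot_law (w : Weights) {a : ℝ} (ha : 0 < a) (N : ℕ)
    {r : ℕ} (κ : Fin r → ℝ) (p : Fin r → Fin (N + 1 + 1) → ℝ)
    (hpos : ∀ x : Fin (N + 1 + 1) → ℝ, x ≠ 0 →
      0 < x ⬝ᵥ ((evenBlock w ⟨a, N + 1, ha⟩ + ∑ j, κ j • vecMulVec (p j) (p j)) *ᵥ x))
    {d' z'' : Fin (N + 1 + 1) → ℝ} {z y : Fin (N + 1) → ℝ}
    (hz : (evenBlock w ⟨a, N, ha⟩ + ∑ j, κ j • vecMulVec (p j ∘ Fin.castSucc) (p j ∘ Fin.castSucc)) *ᵥ z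
      = d' ∘ Fin.castSucc)
    (hy : (evenBlock w ⟨a, N, ha⟩ + ∑ j, κ j • vecMulVec (p j ∘ Fin.castSucc) (p j ∘ Fin.castSucc)) *ᵥ y
      = fun i => (evenBlock w ⟨a, N + 1, ha⟩ + ∑ j, κ j • vecMulVec (p j) (p j)) (Fin.castSucc i) (Fin.last (N + 1)))
    (hz'' : (evenBlock w ⟨a, N + 1, ha⟩ + ∑ j, κ j • vecMulVec (p j) (p j)) *ᵥ z'' = d') :
    d' ⬝ᵥ z'' - (d' ∘ Fin.castSucc) ⬝ᵥ z =
        (d' (Fin.last (N + 1)) - (fun i => (evenBlock w ⟨a, N + 1, ha⟩ + ∑ j, κ j • vecMulVec (p j) (p j))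
            (Fin.castSucc i) (Fin.last (N + 1))) ⬝ᵥ z) ^ 2 /
          ((evenBlock w ⟨a, N + 1, ha⟩ + ∑ j, κ j • vecMulVec (p j) (p j)) (Fin.last (N + 1)) (Fin.last (N + 1)) -
            (fun i => (evenBlock w ⟨a, N + 1, ha⟩ + ∑ j, κ j • vecMulVec (p j) (p j))
              (Fin.castSucc i) (Fin.last (N + 1))) ⬝ᵥ y) ∧
      0 < (evenBlock w ⟨a, N + 1, ha⟩ + ∑ j, κ j • vecMulVec (p j) (p j)) (Fin.last (N + 1)) (Fin.last (N + 1)) -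
            (fun i => (evenBlock w ⟨a, N + 1, ha⟩ + ∑ j, κ j • vecMulVec (p j) (p j))
              (Fin.castSucc i) (Fin.last (N + 1))) ⬝ᵥ y := by
  set B' := evenBlock w ⟨a, N + 1, ha⟩ + ∑ j, κ j • vecMulVec (p j) (p j) with hB'_def
  have hB' : B'.IsSymm := isSymm_add_sum_vecMulVec (evenBlock_isSymm w ⟨a, N + 1, ha⟩) κ p
  have hnest : evenBlock w ⟨a, N, ha⟩ + ∑ j, κ j • vecMulVec (p j ∘ Fin.castSucc) (p j ∘ Fin.castSucc) =
      B'.submatrix Fin.castSucc Fin.castSucc := by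
    rw [hB'_def, submatrix_add_sum_vecMulVec, ← castLE_eq_castSucc N]
    have hQ : evenBlock w ⟨a, N, ha⟩ =
        (evenBlock w ⟨a, N + 1, ha⟩).submatrix (Fin.castLE (Nat.succ_le_succ (Nat.le_succ N)))
          (Fin.castLE (Nat.succ_le_succ (Nat.le_succ N))) :=
      datumOf_nested w a ha N (N + 1) (Nat.le_succ N)
    rw [hQ]
  rw [hnest] at hz hy
  exact ⟨pivot_law hB' hz hy (schur_pos hB' hpos hy).ne' hz'', schur_pos hB' hpos hy⟩

end Summit.RiemannHypothesis.RiemannHypothesis.Theorems.PfPersistenceIntruderCapacitancePivot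

end
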